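import Mathlib
import Literature.NumberTheory.Transcendental.GammaFields

/-!
# Transport of the Γ-field predimension along field embeddings

Support file for stub `stub_doubleModel` of line `eac-extends-core-automorphisms` (crux
`RigidCore.AclSubsetLogFreeCore`, stmt-Schanuel-0968).  Bays–Kirby's countable model
`BKModel.exists_countable_seac_model` comes with a field embedding `ιM : K →+* M` of the base
partial exponential field which intertwines the partial exponential `θ` of `K` with `exp` of
`M`; the double of stub `stub_doubleBase` comes with two embeddings `j₁ j₂ : F →+* K` of a
subfield `F ⊆ ℂ`.  To move the Γ-field bookkeeping of `GammaFields.lean` (`td`, `ldim`,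
`predim`, `fieldOf`) across such embeddings one needs:

* `matroid_relRank_comap`: relative rank is invariant under `Matroid.comap` along an injective
  map; `algMatroid_eq_comap`: the algebraic matroid of a subfield is the comap of the algebraic
  matroid (an injective ring homomorphism of fields of characteristic zero preserves and reflects
  algebraic independence over `ℚ`); hence `relRank_image_image`.
* `ldim_map_map`, `isFG_map_map_iff`: relative linear dimension is invariant under injective
  linear maps.
* for a field `A` with a map `ex : A → A` and an embedding `ι : A →+* E` into an exponential
  field with `exp (ι x) = ι (ex x)` on the relevant subspaces: `gens_map_eq`, `td_map_map`,
  `predim_map_map`, `fieldOf_map_toSubfield`, and the two-target corollary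
  `predim_map_eq_predim_map` (the predimension computed in two exponential fields through two
  such embeddings is the same).

Everything is elementary and fully proved. [folklore]
-/

noncomputable section

-- `Summit.Schanuel.Schanuel.…` is the single-problem-summit namespace by design (D-0017).
set_option linter.dupNamespace false

open Set Matroid
open Literature.ModelTheory.ExponentialFields Literature.ModelTheory.ExponentialFields.ExponentialRing
open Literature.NumberTheory.Transcendental Literature.NumberTheory.Transcendental.GammaField

namespace Summit.Schanuel.Schanuel.Theorems.RigidCore

/-! ### Relative rank along injective maps of matroids -/

/-- Relative rank from nested bases: if `J` is a basis of `C` and `K ⊇ J` a basis of `C ∪ X`,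
then `relRank C X = #(K ∖ J)`. [folklore] -/
theorem relRank_eq_encard_of_isBasis' {γ : Type*} (P : Matroid γ) {C X J K : Set γ}
    (hJ : P.IsBasis' J C) (hK : P.IsBasis' K (C ∪ X)) (hJK : J ⊆ K) :
    P.relRank C X = (K \ J).encard := by
  have hloops : (C \ J) ∩ (P ／ J).E ⊆ (P ／ J).loops := by
    rintro x ⟨⟨hxC, hxJ⟩, hxE⟩
    rw [Matroid.contract_loops_eq]
    refine ⟨?_, hxJ⟩
    rw [hJ.closure_eq_closure]
    rw [Matroid.contract_ground] at hxE
    exact P.inter_ground_subset_closure C ⟨hxC, hxE.1⟩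
  rw [← Matroid.relRank_union_self_left, Matroid.relRank_eq_eRk_contract,
    hJ.contract_eq_contract_delete, Matroid.eRk_delete_eq_of_subset_loops hloops,
    ← (hK.contract_isBasis'_sdiff_of_subset hJK).encard_eq_eRk]

/-- **Relative rank is invariant under `Matroid.comap` along an injective map.** [folklore] -/
theorem matroid_relRank_comap {α β : Type*} (N : Matroid β) {f : α → β}
    (hf : Function.Injective f) (C X : Set α) :
    (N.comap f).relRank C X = N.relRank (f '' C) (f '' X) := by
  obtain ⟨J, hJ⟩ := (N.comap f).exists_isBasis' C
  obtain ⟨K, hK, hJK⟩ := hJ.indep.subset_isBasis'_of_subset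
    (hJ.subset.trans (subset_union_left (t := X)))
  rw [relRank_eq_encard_of_isBasis' _ hJ hK hJK]
  obtain ⟨hJ', -, -⟩ := Matroid.comap_isBasis'_iff.1 hJ
  obtain ⟨hK', -, -⟩ := Matroid.comap_isBasis'_iff.1 hK
  rw [image_union] at hK'
  rw [relRank_eq_encard_of_isBasis' N hJ' hK' (image_mono hJK), ← image_sdiff hf,
    hf.encard_image]

/-! ### The algebraic matroid of a subfield -/

section AlgMatroid

variable {A E : Type*} [Field A] [CharZero A] [Field E] [CharZero E]

/-- **The algebraic matroid (over `ℚ`) of a field `A` embedded in a field `E` is the comap of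
the algebraic matroid of `E`**: an injective ring homomorphism preserves and reflects algebraic
independence over `ℚ`. [folklore] -/
theorem algMatroid_eq_comap (ι : A →+* E) : algMatroid A = (algMatroid E).comap ι := by
  refine Matroid.ext_indep (by simp) fun I _ => ?_
  rw [Matroid.comap_indep_iff, AlgebraicIndependent.matroid_indep_iff,
    AlgebraicIndependent.matroid_indep_iff, and_iff_left ι.injective.injOn]
  change AlgebraicIndependent ℚ (fun x : I => (x : A)) ↔
    AlgebraicIndependent ℚ (fun x : ι '' I => (x : E))
  rw [← algebraicIndependent_image ι.injective.injOn]
  exact (AlgHom.algebraicIndependent_iff ι.toRatAlgHom ι.injective).symm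

/-- **Relative algebraic rank is invariant under field embeddings**:
`relRank (ι C) (ι X) = relRank C X`. [folklore] -/
theorem relRank_image_image (ι : A →+* E) (C X : Set A) :
    (algMatroid E).relRank (ι '' C) (ι '' X) = (algMatroid A).relRank C X := by
  rw [algMatroid_eq_comap ι, matroid_relRank_comap _ ι.injective]

/-- Relative algebraic closure is reflected by field embeddings: `ι a ∈ acl (ι s) ↔ a ∈ acl s`.
[folklore] -/
theorem mem_acl_image_iff (ι : A →+* E) {s : Set A} {a : A} : ι a ∈ acl (ι '' s) ↔ a ∈ acl s := by
  rw [acl, acl, algMatroid_eq_comap ι, Matroid.comap_closure_eq, mem_preimage]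

end AlgMatroid

/-! ### Relative linear dimension along injective linear maps -/

section Ldim

variable {k V V₂ : Type*} [Field k] [AddCommGroup V] [Module k V] [AddCommGroup V₂] [Module k V₂]

/-- The map `V ⧸ Λ → V₂ ⧸ f(Λ)` induced by an injective linear map is injective, and it carries the
image of `Λ'` to the image of `f(Λ')`. [folklore] -/
theorem map_mkQ_map_eq (f : V →ₗ[k] V₂) (hf : Function.Injective f) (Λ Λ' : Submodule k V) :
    ∃ g : V ⧸ Λ →ₗ[k] V₂ ⧸ Λ.map f, Function.Injective g ∧
      (Λ'.map f).map (Λ.map f).mkQ = (Λ'.map Λ.mkQ).map g := by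
  have hle : Λ ≤ (Λ.map f).comap f := Submodule.le_comap_map _ _
  refine ⟨Λ.mapQ (Λ.map f) f hle, ?_, ?_⟩
  · rw [← LinearMap.ker_eq_bot, Submodule.mapQ, Submodule.ker_liftQ, LinearMap.ker_comp,
      Submodule.ker_mkQ, Submodule.comap_map_eq_of_injective hf, Submodule.mkQ_map_self]
  · rw [← Submodule.map_comp, ← Submodule.map_comp]
    congr 1

/-- **Relative linear dimension is invariant under injective linear maps.** [folklore] -/
theorem ldim_map_map (f : V →ₗ[k] V₂) (hf : Function.Injective f) (Λ Λ' : Submodule k V) :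
    ldim (Λ.map f) (Λ'.map f) = ldim Λ Λ' := by
  obtain ⟨g, hg, hcomm⟩ := map_mkQ_map_eq f hf Λ Λ'
  unfold ldim
  rw [hcomm]
  exact (LinearEquiv.finrank_eq (Submodule.equivMapOfInjective g hg _)).symm

/-- Finite generation of extensions is invariant under injective linear maps. [folklore] -/
theorem isFG_map_map_iff (f : V →ₗ[k] V₂) (hf : Function.Injective f) (Λ Λ' : Submodule k V) :
    IsFG (Λ.map f) (Λ'.map f) ↔ IsFG Λ Λ' := by
  obtain ⟨g, hg, hcomm⟩ := map_mkQ_map_eq f hf Λ Λ'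
  unfold IsFG
  rw [hcomm]
  exact ⟨fun h => Submodule.fg_of_fg_map_injective g hg h, fun h => h.map g⟩

/-- Finitely generated subspaces give finitely generated extensions. [folklore] -/
theorem isFG_of_fg {Λ' : Submodule k V} (h : Λ'.FG) (Λ : Submodule k V) : IsFG Λ Λ' :=
  h.map _

end Ldim

/-! ### Γ-field quantities through an embedding intertwining a partial exponential -/

section Transport

variable {A : Type*} [Field A] [Module ℚ A]
variable {E : Type*} [Field E] [CharZero E] [ExponentialRing E]
variable (ι : A →+* E) (f : A →ₗ[ℚ] E) (hf : ∀ x, f x = ι x) (ex : A → A)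

include hf in
omit [ExponentialRing E] in
/-- The carrier of `Λ.map f` is `ι(Λ)`. [folklore] -/
theorem coe_map_eq_image (Λ : Submodule ℚ A) : ((Λ.map f : Submodule ℚ E) : Set E) = ι '' Λ := by
  rw [Submodule.map_coe]
  exact image_congr fun x _ => hf x

include hf in
omit [ExponentialRing E] in
/-- Membership in `Λ.map f`. [folklore] -/
theorem mem_map_iff_of_eq {Λ : Submodule ℚ A} {y : E} : y ∈ Λ.map f ↔ ∃ x ∈ Λ, ι x = y := by
  rw [← SetLike.mem_coe, coe_map_eq_image ι f hf, mem_image]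
  rfl

include hf in
omit [ExponentialRing E] in
/-- `ι x ∈ Λ.map f ↔ x ∈ Λ`. [folklore] -/
theorem apply_mem_map_iff {Λ : Submodule ℚ A} {x : A} : ι x ∈ Λ.map f ↔ x ∈ Λ := by
  rw [mem_map_iff_of_eq ι f hf]
  constructor
  · rintro ⟨x', hx', h⟩
    rwa [← ι.injective h]
  · exact fun hx => ⟨x, hx, rfl⟩

include hf in
/-- **Generators through the embedding**: if `exp ∘ ι = ι ∘ ex` on `Λ` then
`gens (ι Λ) = ι (Λ ∪ ex Λ)`. [folklore] -/
theorem gens_map_eq {Λ : Submodule ℚ A} (hΛ : ∀ x ∈ Λ, exp (ι x) = ι (ex x)) :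
    gens (Λ.map f) = ι '' ((Λ : Set A) ∪ ex '' Λ) := by
  rw [gens, coe_map_eq_image ι f hf, image_union, image_image, image_image]
  congr 1
  exact image_congr fun x hx => hΛ x hx

include hf in
/-- **Transcendence degree through the embedding**: `td (ι Λ) (ι Λ')` is the relative algebraic
rank of `Λ' ∪ ex Λ'` over `Λ ∪ ex Λ` computed in `A`. [folklore] -/
theorem td_map_map [CharZero A] {Λ Λ' : Submodule ℚ A} (hΛ : ∀ x ∈ Λ, exp (ι x) = ι (ex x))
    (hΛ' : ∀ x ∈ Λ', exp (ι x) = ι (ex x)) :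
    td (Λ.map f) (Λ'.map f) =
      (algMatroid A).relRank ((Λ : Set A) ∪ ex '' Λ) ((Λ' : Set A) ∪ ex '' Λ') := by
  rw [td_def, gens_map_eq ι f hf ex hΛ, gens_map_eq ι f hf ex hΛ', relRank_image_image]

include hf in
/-- **Predimension through the embedding.** [folklore] -/
theorem predim_map_map [CharZero A] {Λ Λ' : Submodule ℚ A} (hΛ : ∀ x ∈ Λ, exp (ι x) = ι (ex x))
    (hΛ' : ∀ x ∈ Λ', exp (ι x) = ι (ex x)) :
    predim (Λ.map f) (Λ'.map f) =
      (((algMatroid A).relRank ((Λ : Set A) ∪ ex '' Λ) ((Λ' : Set A) ∪ ex '' Λ')).toNat : ℤ) -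
        (ldim Λ Λ' : ℤ) := by
  have hinj : Function.Injective f := fun x y hxy => ι.injective (by rwa [hf, hf] at hxy)
  rw [predim_def, td_map_map ι f hf ex hΛ hΛ', ldim_map_map f hinj]

include hf in
/-- **The Γ-subfield through the embedding**: `ℚ(gens (ι Λ))` is the image of the subfield of
`A` generated by `Λ ∪ ex Λ`. [folklore] -/
theorem fieldOf_map_toSubfield {Λ : Submodule ℚ A} (hΛ : ∀ x ∈ Λ, exp (ι x) = ι (ex x)) :
    (fieldOf (Λ.map f)).toSubfield = (Subfield.closure ((Λ : Set A) ∪ ex '' Λ)).map ι := by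
  rw [fieldOf, IntermediateField.adjoin_toSubfield, RingHom.map_field_closure,
    ← gens_map_eq ι f hf ex hΛ]
  refine le_antisymm (Subfield.closure_le.2 (union_subset ?_ Subfield.subset_closure))
    (Subfield.closure_mono subset_union_right)
  rintro _ ⟨q, rfl⟩
  rw [eq_ratCast]
  exact SubfieldClass.ratCast_mem _ q

include hf in
/-- Membership form of `fieldOf_map_toSubfield`. [folklore] -/
theorem mem_fieldOf_map_iff {Λ : Submodule ℚ A} (hΛ : ∀ x ∈ Λ, exp (ι x) = ι (ex x)) {y : E} :
    y ∈ fieldOf (Λ.map f) ↔ ∃ r ∈ Subfield.closure ((Λ : Set A) ∪ ex '' Λ), ι r = y := by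
  rw [← IntermediateField.mem_toSubfield, fieldOf_map_toSubfield ι f hf ex hΛ, Subfield.mem_map]

end Transport

section TwoTargets

variable {A : Type*} [Field A] [Module ℚ A]
variable {E₁ : Type*} [Field E₁] [CharZero E₁] [ExponentialRing E₁]
variable {E₂ : Type*} [Field E₂] [CharZero E₂] [ExponentialRing E₂]
variable (ι₁ : A →+* E₁) (f₁ : A →ₗ[ℚ] E₁) (hf₁ : ∀ x, f₁ x = ι₁ x)
variable (ι₂ : A →+* E₂) (f₂ : A →ₗ[ℚ] E₂) (hf₂ : ∀ x, f₂ x = ι₂ x) (ex : A → A)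

include hf₁ hf₂ in
/-- **The predimension does not depend on the ambient exponential field**: computed through two
embeddings which both intertwine `ex` with `exp` on `Λ` and `Λ'`, `δ(Λ'/Λ)` is the same.
[folklore] -/
theorem predim_map_eq_predim_map [CharZero A] {Λ Λ' : Submodule ℚ A}
    (h₁ : ∀ x ∈ Λ, exp (ι₁ x) = ι₁ (ex x)) (h₁' : ∀ x ∈ Λ', exp (ι₁ x) = ι₁ (ex x))
    (h₂ : ∀ x ∈ Λ, exp (ι₂ x) = ι₂ (ex x)) (h₂' : ∀ x ∈ Λ', exp (ι₂ x) = ι₂ (ex x)) :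
    predim (Λ.map f₁) (Λ'.map f₁) = predim (Λ.map f₂) (Λ'.map f₂) := by
  rw [predim_map_map ι₁ f₁ hf₁ ex h₁ h₁', predim_map_map ι₂ f₂ hf₂ ex h₂ h₂']

include hf₁ hf₂ in
/-- Likewise for the transcendence degree. [folklore] -/
theorem td_map_eq_td_map [CharZero A] {Λ Λ' : Submodule ℚ A}
    (h₁ : ∀ x ∈ Λ, exp (ι₁ x) = ι₁ (ex x)) (h₁' : ∀ x ∈ Λ', exp (ι₁ x) = ι₁ (ex x))
    (h₂ : ∀ x ∈ Λ, exp (ι₂ x) = ι₂ (ex x)) (h₂' : ∀ x ∈ Λ', exp (ι₂ x) = ι₂ (ex x)) :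
    td (Λ.map f₁) (Λ'.map f₁) = td (Λ.map f₂) (Λ'.map f₂) := by
  rw [td_map_map ι₁ f₁ hf₁ ex h₁ h₁', td_map_map ι₂ f₂ hf₂ ex h₂ h₂']

include hf₁ hf₂ in
omit [ExponentialRing E₁] [ExponentialRing E₂] in
/-- Likewise for finite generation. [folklore] -/
theorem isFG_map_iff_isFG_map (Λ Λ' : Submodule ℚ A) :
    IsFG (Λ.map f₁) (Λ'.map f₁) ↔ IsFG (Λ.map f₂) (Λ'.map f₂) := by
  have h₁ : Function.Injective f₁ := fun x y hxy => ι₁.injective (by rwa [hf₁, hf₁] at hxy)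
  have h₂ : Function.Injective f₂ := fun x y hxy => ι₂.injective (by rwa [hf₂, hf₂] at hxy)
  rw [isFG_map_map_iff f₁ h₁, isFG_map_map_iff f₂ h₂]

end TwoTargets

/-- Registered sub-goal alias (for `--supports stmt-Schanuel-0968`): relative algebraic rank is
invariant under field embeddings. -/
theorem doubleModel_relRank_image_image {A E : Type*} [Field A] [CharZero A] [Field E] [CharZero E]
    (ι : A →+* E) (C X : Set A) :
    (algMatroid E).relRank (ι '' C) (ι '' X) = (algMatroid A).relRank C X :=
  relRank_image_image ι C X

end Summit.Schanuel.Schanuel.Theorems.RigidCore
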